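import Summits.HubbardSuperconductivity.HubbardLadder.Bounds.NumberConservingGaugeFunctionBound
import Summits.HubbardSuperconductivity.HubbardLadder.Bounds.StiffnessCeilingCurrentMoments
import HarnessLib

/-!
# Bounds node: trial-direction (Hylleraas) stiffness ceiling for the number-conserving class on
# ANY finite hopping graph, fixed twist one-form (`bounds.tex` Theorem 6(i) = Thms 4 ⊕ 5♯)

HONEST FRAMING: ladder R1–R4 with certified numbers; no claim on H/H₀. A BOUND FOR A MODEL CLASS
(no materials claim, no certified instance claimed), proved sorry-free; nothing here is cited.

Cell `pub-hubbard`, unit `pub-hubbard-bounds` (gen 9). Class `𝔥` of `bounds.tex` Def. 1, typed as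
in `NumberConservingGaugeFunctionBound.lean`: finite site set `Λ`, real symmetric hopping `t_{xy}`
(any sign / range), ANTISYMMETRIC TWIST ONE-FORM `d_{xy}` (e.g. `e₁·(bond vector)`, any boundary
twist), `H(θd) = Σ_{x,y,σ} t_{xy} e^{iθd_{xy}} c†_{xσ}c_{yσ} + V` with `V` Hermitian (ANY
interaction; no gauge invariance or reality needed here), `E(θ) = E_{N,M}(H(θd))` the
`(N, S^z = M)`-sector minimum, `ψ` a unit sector ground state of `H₀ = H(0)`, `E₀ = E(0)`.

THEOREM (node `TrialDirectionStiffnessCeilingOneForm`, PROVED; T = 0). If `ρθ² ≤ E(θ) − E(0)` for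
`|θ| ≤ θ₀` (`θ₀ > 0`, `ρ` of either sign), then for EVERY vector `η` of the sector
`ρ ≤ ½ Σ d_{xy}² (−t_{xy} Re⟨ψ, c†_{xσ}c_{yσ}ψ⟩) − 2Re⟨η, J_dψ⟩ + (Re⟨η, H₀η⟩ − E₀‖η‖²)`,
`J_d = Σ i t_{xy}d_{xy} c†_{xσ}c_{yσ} = ∂_θH(θd)|₀`. First term: the exact-weight resistor-network
ceiling (`η = 0`, `bounds.tex` Thm 4, node `StiffnessCeilingNumberConserving`); the rest: the
Hylleraas functional of the trial first-order vector `η` (Thm 5♯, there for the torus only), whose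
infimum is minus the full Kubo paramagnetic term — no spectral decomposition, gap or
non-degeneracy hypothesis. PROOF: Rayleigh–Ritz in the sector at `+θ` with `ψ − θη` and at `−θ`
with `ψ + θη`; with `H(θd) = H₀ + K(θ) + J(θ)` (`bdgHopping_peierls_split`; `K` even, `J` odd in
`θ`) the odd terms cancel: `ρθ²(1 + θ²‖η‖²) ≤ θ²B(η) + ⟨ψ,Kψ⟩ + θ²⟨η,Kη⟩ − 2θRe⟨η,Jψ⟩`, then
`θ → 0` (`le_of_forall_trialFlux`). Gauge-function form and corollaries:
`NumberConservingTrialDirectionGauge.lean`. Refs: Scalapino–White–Zhang, PRB 47 (1993) 7995,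
§II; Paramekanti–Trivedi–Randeria, PRB 57 (1998) 11639, §IV; Hylleraas, Z. Phys. 65 (1930) 209 /
Epstein, *The variation method in quantum chemistry* (1974) ch. VII. Combination and proof ours.
-/

noncomputable section

namespace Summit.HubbardSuperconductivity.HubbardLadder.Bounds

open Matrix Finset Literature.MathematicalPhysics.QuantumLattice
  Literature.MathematicalPhysics.QuantumFieldTheory

open scoped ComplexConjugate ComplexOrder

/-! ### Taylor bounds and the `θ → 0` extraction with a first-order (paramagnetic) term -/

section Limit

/-- `(cos x − 1) w ≤ −(x²/2) w + (5/96) x⁴ |w|` for `|x| ≤ 1`. [folklore] -/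
theorem cos_sub_one_mul_le {x : ℝ} (hx : |x| ≤ 1) (w : ℝ) :
    (Real.cos x - 1) * w ≤ -(x ^ 2 / 2) * w + 5 / 96 * x ^ 4 * |w| := by
  have hb := abs_one_sub_cos_sub_le (abs_nonneg x) hx
  have h4 : |x| ^ 4 = x ^ 4 := by
    rw [show (4 : ℕ) = 2 * 2 from rfl, pow_mul, pow_mul, sq_abs]
  rw [Real.cos_abs, sq_abs, h4] at hb
  have h1 : -(((1 - Real.cos x) - x ^ 2 / 2) * w) ≤ |(1 - Real.cos x) - x ^ 2 / 2| * |w| := by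
    rw [← abs_mul]; exact neg_le_abs _
  have h2 : |(1 - Real.cos x) - x ^ 2 / 2| * |w| ≤ 5 / 96 * x ^ 4 * |w| :=
    mul_le_mul_of_nonneg_right hb (abs_nonneg w)
  have e : (Real.cos x - 1) * w = -(x ^ 2 / 2) * w + -(((1 - Real.cos x) - x ^ 2 / 2) * w) :=
    by ring
  rw [e]; linarith

/-- `(cos x − 1) p ≤ (x²/2) |p|` for every `x`. [folklore] -/
theorem cos_sub_one_mul_le' (x p : ℝ) : (Real.cos x - 1) * p ≤ x ^ 2 / 2 * |p| := by
  have h0 : 0 ≤ 1 - Real.cos x := sub_nonneg.2 (Real.cos_le_one x)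
  have h2 : 1 - Real.cos x ≤ x ^ 2 / 2 := by linarith [Real.one_sub_sq_div_two_le_cos (x := x)]
  calc (Real.cos x - 1) * p = (1 - Real.cos x) * (-p) := by ring
    _ ≤ (1 - Real.cos x) * |p| := mul_le_mul_of_nonneg_left (neg_le_abs p) h0
    _ ≤ x ^ 2 / 2 * |p| := mul_le_mul_of_nonneg_right h2 (abs_nonneg p)

/-- `sin x · q ≤ x q + |x|³ |q|` for `|x| ≤ 1` (`Real.sin_bound`). [folklore] -/
theorem sin_mul_le {x : ℝ} (hx : |x| ≤ 1) (q : ℝ) :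
    Real.sin x * q ≤ x * q + |x| ^ 3 * |q| := by
  have hs : |Real.sin x - x| ≤ |x| ^ 3 := by
    have h := Real.sin_bound hx
    have h0 := abs_nonneg x
    have h5 : |x| ^ 3 * (|x| * |x|) ≤ |x| ^ 3 * (1 * 1) := by gcongr
    have h6 : |-(x ^ 3 / 6)| = |x| ^ 3 / 6 := by
      rw [abs_neg, abs_div, abs_pow, abs_of_pos (by norm_num : (0 : ℝ) < 6)]
    calc |Real.sin x - x| = |(Real.sin x - (x - x ^ 3 / 6)) + (-(x ^ 3 / 6))| := by ring_nf
      _ ≤ |Real.sin x - (x - x ^ 3 / 6)| + |-(x ^ 3 / 6)| := abs_add_le _ _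
      _ ≤ |x| ^ 5 / 100 + |x| ^ 3 / 6 := by rw [h6]; exact add_le_add h le_rfl
      _ ≤ |x| ^ 3 := by nlinarith [pow_nonneg h0 3, h5]
  have h1 : (Real.sin x - x) * q ≤ |Real.sin x - x| * |q| := by
    rw [← abs_mul]; exact le_abs_self _
  have h2 := mul_le_mul_of_nonneg_right hs (abs_nonneg q)
  have e : Real.sin x * q = x * q + (Real.sin x - x) * q := by ring
  rw [e]; linarith

/-- **The `θ → 0` extraction with a paramagnetic term**: if for `θ ∈ (0, θ₁]`
`ρθ²(1 + θ²c) ≤ θ²r + Σ a(cos θv − 1)w + θ² Σ a(cos θv − 1)p + 2θ Σ a sin(θv) q`, then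
`ρ ≤ r + Σ v²(−aw)/2 + 2 Σ a v q` (second-order Taylor; all reals of either sign). [folklore] -/
theorem le_of_forall_trialFlux {ι : Type*} [Fintype ι] {ρ θ₁ c r : ℝ} (hθ₁ : 0 < θ₁)
    (a v w p q : ι → ℝ)
    (h : ∀ θ : ℝ, 0 < θ → θ ≤ θ₁ →
      ρ * θ ^ 2 * (1 + θ ^ 2 * c) ≤
        θ ^ 2 * r + ∑ i, a i * (Real.cos (θ * v i) - 1) * w i +
          θ ^ 2 * ∑ i, a i * (Real.cos (θ * v i) - 1) * p i +
          2 * θ * ∑ i, a i * Real.sin (θ * v i) * q i) :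
    ρ ≤ r + ∑ i, v i ^ 2 * (-(a i * w i) / 2) + 2 * ∑ i, a i * v i * q i := by
  by_contra hlt
  have hε : 0 < ρ - (r + ∑ i, v i ^ 2 * (-(a i * w i) / 2) + 2 * ∑ i, a i * v i * q i) :=
    sub_pos.2 (lt_of_not_ge hlt)
  have hG0 : 0 ≤ ∑ i, (5 / 96 * v i ^ 4 * |a i * w i| + v i ^ 2 / 2 * |a i * p i| +
      2 * |v i| ^ 3 * |a i * q i|) :=
    Finset.sum_nonneg fun i _ => by positivity
  have hC0 : 0 ≤ |ρ| * |c| + ∑ i, (5 / 96 * v i ^ 4 * |a i * w i| + v i ^ 2 / 2 * |a i * p i| +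
      2 * |v i| ^ 3 * |a i * q i|) := by positivity
  have hx₁ : 0 < min θ₁ (1 / (∑ i, |v i| + 1)) := lt_min hθ₁ (by positivity)
  refine false_of_forall_le_mul_sq hε hC0 hx₁ fun x hx hx1 => ?_
  have hxθ : x ≤ θ₁ := hx1.trans (min_le_left _ _)
  have hxD : x * (∑ i, |v i| + 1) ≤ 1 := by
    have h' := hx1.trans (min_le_right _ _)
    rwa [le_div_iff₀ (by positivity)] at h'
  have hxv : ∀ i, |x * v i| ≤ 1 := fun i => by
    rw [abs_mul, abs_of_pos hx]
    have hi : |v i| ≤ ∑ j, |v j| :=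
      Finset.single_le_sum (fun j _ => abs_nonneg (v j)) (Finset.mem_univ i)
    nlinarith [abs_nonneg (v i)]
  have hmain := h x hx hxθ
  -- termwise second-order bounds
  have hterm : ∀ i,
      a i * (Real.cos (x * v i) - 1) * w i + x ^ 2 * (a i * (Real.cos (x * v i) - 1) * p i) +
          2 * x * (a i * Real.sin (x * v i) * q i) ≤
        x ^ 2 * (v i ^ 2 * (-(a i * w i) / 2) + 2 * (a i * v i * q i)) +
          x ^ 4 * (5 / 96 * v i ^ 4 * |a i * w i| + v i ^ 2 / 2 * |a i * p i| +
            2 * |v i| ^ 3 * |a i * q i|) := by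
    intro i
    have e1 := cos_sub_one_mul_le (hxv i) (a i * w i)
    have e2 := cos_sub_one_mul_le' (x * v i) (x ^ 2 * (a i * p i))
    rw [abs_mul, abs_of_pos (pow_pos hx 2)] at e2
    have e3 := mul_le_mul_of_nonneg_left (sin_mul_le (hxv i) (a i * q i)) hx.le
    rw [abs_mul, abs_of_pos hx] at e3
    have etot : (-((x * v i) ^ 2 / 2) * (a i * w i) + 5 / 96 * (x * v i) ^ 4 * |a i * w i|) +
        (x * v i) ^ 2 / 2 * (x ^ 2 * |a i * p i|) +
        2 * (x * (x * v i * (a i * q i) + (x * |v i|) ^ 3 * |a i * q i|)) =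
        x ^ 2 * (v i ^ 2 * (-(a i * w i) / 2) + 2 * (a i * v i * q i)) +
          x ^ 4 * (5 / 96 * v i ^ 4 * |a i * w i| + v i ^ 2 / 2 * |a i * p i| +
            2 * |v i| ^ 3 * |a i * q i|) := by
      ring
    have f1 : a i * (Real.cos (x * v i) - 1) * w i = (Real.cos (x * v i) - 1) * (a i * w i) := by
      ring
    have f2 : x ^ 2 * (a i * (Real.cos (x * v i) - 1) * p i) =
        (Real.cos (x * v i) - 1) * (x ^ 2 * (a i * p i)) := by ring
    have f3 : 2 * x * (a i * Real.sin (x * v i) * q i) =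
        2 * (x * (Real.sin (x * v i) * (a i * q i))) := by ring
    rw [f1, f2, f3, ← etot]; linarith
  have hsum := Finset.sum_le_sum fun i (_ : i ∈ Finset.univ) => hterm i
  rw [Finset.sum_add_distrib, Finset.sum_add_distrib, ← Finset.mul_sum, ← Finset.mul_sum,
    Finset.sum_add_distrib, ← Finset.mul_sum, ← Finset.mul_sum, Finset.sum_add_distrib,
    ← Finset.mul_sum] at hsum
  -- lower bound for the left-hand side
  have hl : ρ * x ^ 2 - |ρ| * |c| * x ^ 4 ≤ ρ * x ^ 2 * (1 + x ^ 2 * c) := by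
    have hρc : -(|ρ| * |c|) ≤ ρ * c := by rw [← abs_mul]; exact neg_abs_le _
    have h4 := mul_le_mul_of_nonneg_right hρc (pow_nonneg hx.le 4)
    have e : ρ * x ^ 2 * (1 + x ^ 2 * c) = ρ * x ^ 2 + ρ * c * x ^ 4 := by ring
    rw [e]; linarith
  have key : (ρ - (r + ∑ i, v i ^ 2 * (-(a i * w i) / 2) + 2 * ∑ i, a i * v i * q i)) * x ^ 2 ≤
      (|ρ| * |c| + ∑ i, (5 / 96 * v i ^ 4 * |a i * w i| + v i ^ 2 / 2 * |a i * p i| +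
        2 * |v i| ^ 3 * |a i * q i|)) * x ^ 2 * x ^ 2 := by
    have e : (|ρ| * |c| + ∑ i, (5 / 96 * v i ^ 4 * |a i * w i| + v i ^ 2 / 2 * |a i * p i| +
        2 * |v i| ^ 3 * |a i * q i|)) * x ^ 2 * x ^ 2 =
        (|ρ| * |c| + ∑ i, (5 / 96 * v i ^ 4 * |a i * w i| + v i ^ 2 / 2 * |a i * p i| +
          2 * |v i| ^ 3 * |a i * q i|)) * x ^ 4 := by ring
    rw [e]
    nlinarith [hmain, hsum, hl]
  exact le_of_mul_le_mul_right key (pow_pos hx 2)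

/-- `le_of_forall_trialFlux` for a bond family indexed by `Λ × Λ × Fin 2`, iterated sums. -/
theorem le_of_forall_trialFlux₃ {Λ : Type*} [Fintype Λ] {ρ θ₁ c r : ℝ} (hθ₁ : 0 < θ₁)
    (a v : Λ → Λ → ℝ) (w p q : Λ → Λ → Fin 2 → ℝ)
    (h : ∀ θ : ℝ, 0 < θ → θ ≤ θ₁ →
      ρ * θ ^ 2 * (1 + θ ^ 2 * c) ≤
        θ ^ 2 * r + ∑ x : Λ, ∑ y : Λ, ∑ σ : Fin 2, a x y * (Real.cos (θ * v x y) - 1) * w x y σ +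
          θ ^ 2 * ∑ x : Λ, ∑ y : Λ, ∑ σ : Fin 2, a x y * (Real.cos (θ * v x y) - 1) * p x y σ +
          2 * θ * ∑ x : Λ, ∑ y : Λ, ∑ σ : Fin 2, a x y * Real.sin (θ * v x y) * q x y σ) :
    ρ ≤ r + ∑ x : Λ, ∑ y : Λ, ∑ σ : Fin 2, v x y ^ 2 * (-(a x y * w x y σ) / 2) +
      2 * ∑ x : Λ, ∑ y : Λ, ∑ σ : Fin 2, a x y * v x y * q x y σ := by
  have key := le_of_forall_trialFlux (ι := Λ × Λ × Fin 2) hθ₁ (fun i => a i.1 i.2.1)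
    (fun i => v i.1 i.2.1) (fun i => w i.1 i.2.1 i.2.2) (fun i => p i.1 i.2.1 i.2.2)
    (fun i => q i.1 i.2.1 i.2.2) fun θ hθ hθ1 => by
      simpa only [Fintype.sum_prod_type] using h θ hθ hθ1
  simpa only [Fintype.sum_prod_type] using key

end Limit

/-! ### Hopping algebra: `⟨v, T(τ)u⟩` and the split `H(θd) = H₀ + K(θ) + J(θ)` -/

section Hopping

variable {Λ : Type} [LinearOrder Λ] [Fintype Λ]

/-- `⟨v, T(τ) u⟩ = Σ_{x,y,σ} τ_{xy} ⟨v, c†_{xσ}c_{yσ} u⟩`. [folklore] -/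
theorem star_dotProduct_bdgHopping_mulVec (τ : Λ → Λ → ℂ) (v u : Fock (Orb Λ)) :
    star v ⬝ᵥ (bdgHopping τ *ᵥ u) =
      ∑ x : Λ, ∑ y : Λ, ∑ σ : Fin 2,
        τ x y * (star v ⬝ᵥ ((creation (orb x σ) * annihilation (orb y σ)) *ᵥ u)) := by
  simp only [bdgHopping, Matrix.sum_mulVec, smul_mulVec, dotProduct_sum, dotProduct_smul,
    smul_eq_mul]

/-- `Re((r·i) z) = −r Im z`. [folklore] -/
theorem re_ofReal_mul_I_mul (r : ℝ) (z : ℂ) : ((r : ℂ) * Complex.I * z).re = -(r * z.im) := by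
  simp [Complex.mul_re, Complex.mul_im]

/-- `Re⟨v, T(i s) u⟩ = −Σ s_{xy} Im⟨v, c†_{xσ}c_{yσ} u⟩` for real bond weights `s` (paramagnetic
current form). [folklore] -/
theorem re_star_dotProduct_bdgHopping_I_mulVec (s : Λ → Λ → ℝ) (v u : Fock (Orb Λ)) :
    (star v ⬝ᵥ (bdgHopping (fun x y => ((s x y : ℝ) : ℂ) * Complex.I) *ᵥ u)).re =
      -∑ x : Λ, ∑ y : Λ, ∑ σ : Fin 2,
        s x y * (star v ⬝ᵥ ((creation (orb x σ) * annihilation (orb y σ)) *ᵥ u)).im := by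
  rw [star_dotProduct_bdgHopping_mulVec]
  simp only [Complex.re_sum, re_ofReal_mul_I_mul, Finset.sum_neg_distrib]

/-- **The Peierls split** `T(t e^{iθd}) = T(t) + T(t(cos θd − 1)) + T(i t sin θd)`, i.e.
`H(θd) = H₀ + K(θ) + J(θ)`. [folklore] -/
theorem bdgHopping_peierls_split (t d : Λ → Λ → ℝ) (θ : ℝ) :
    bdgHopping (fun x y => (t x y : ℂ) * Complex.exp (((θ * d x y : ℝ) : ℂ) * Complex.I)) =
      bdgHopping (fun x y => (t x y : ℂ)) +
        bdgHopping (fun x y => ((t x y * (Real.cos (θ * d x y) - 1) : ℝ) : ℂ)) +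
        bdgHopping (fun x y => ((t x y * Real.sin (θ * d x y) : ℝ) : ℂ) * Complex.I) := by
  rw [← bdgHopping_add, ← bdgHopping_add]
  congr 1
  funext x y
  simp only [Pi.add_apply]
  push_cast
  rw [Complex.exp_mul_I]
  ring

/-- `T(w)` is Hermitian for real symmetric bond weights `w`. [folklore] -/
theorem isHermitian_bdgHopping_real {w : Λ → Λ → ℝ} (hw : ∀ x y, w y x = w x y) :
    (bdgHopping fun x y => ((w x y : ℝ) : ℂ)).IsHermitian :=
  isHermitian_bdgHopping fun x y => by
    rw [hw x y, Complex.star_def, Complex.conj_ofReal]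

/-- `T(i s)` is Hermitian for real antisymmetric bond weights `s`. [folklore] -/
theorem isHermitian_bdgHopping_I {s : Λ → Λ → ℝ} (hs : ∀ x y, s y x = -s x y) :
    (bdgHopping fun x y => ((s x y : ℝ) : ℂ) * Complex.I).IsHermitian :=
  isHermitian_bdgHopping fun x y => by
    rw [hs x y, Complex.star_def, map_mul, Complex.conj_ofReal, Complex.conj_I, Complex.ofReal_neg]
    ring

/-- `K(−θ) = K(θ)`. [folklore] -/
theorem bdgHopping_cos_neg (t d : Λ → Λ → ℝ) (θ : ℝ) :
    bdgHopping (fun x y => ((t x y * (Real.cos (-θ * d x y) - 1) : ℝ) : ℂ)) =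
      bdgHopping (fun x y => ((t x y * (Real.cos (θ * d x y) - 1) : ℝ) : ℂ)) := by
  simp only [neg_mul, Real.cos_neg]

/-- `J(−θ) = −J(θ)`. [folklore] -/
theorem bdgHopping_sin_neg (t d : Λ → Λ → ℝ) (θ : ℝ) :
    bdgHopping (fun x y => ((t x y * Real.sin (-θ * d x y) : ℝ) : ℂ) * Complex.I) =
      -bdgHopping (fun x y => ((t x y * Real.sin (θ * d x y) : ℝ) : ℂ) * Complex.I) := by
  rw [← neg_one_smul ℂ
      (bdgHopping fun x y => ((t x y * Real.sin (θ * d x y) : ℝ) : ℂ) * Complex.I),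
    ← bdgHopping_smul]
  congr 1
  funext x y
  simp only [Pi.smul_apply, smul_eq_mul, neg_mul, Real.sin_neg, mul_neg, Complex.ofReal_neg]
  ring

end Hopping

/-! ### The node (fixed one-form `d`, every trial direction `η`) -/

/-- **Trial-direction (Hylleraas) stiffness ceiling for a fixed twist one-form**
(`@[conjecture] def`, PROVED by `trialDirectionStiffnessCeilingOneForm_holds`; bounds.tex
Theorem 6(i); T = 0; a BOUND FOR A MODEL CLASS; no gauge-invariance and no reality hypothesis on
`V`). For every finite `Λ`, real symmetric hopping `t`, antisymmetric one-form `d`, Hermitian `V`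
and sector `(N, M)`: if `ρθ² ≤ E_{N,M}(H(θd)) − E_{N,M}(H₀)` for `|θ| ≤ θ₀` (`θ₀ > 0`, `ρ`
of either sign), then for every unit sector ground state `ψ` of `H₀ = T(t) + V` and every sector
vector `η`: `ρ ≤ ½ Σ d_{xy}²(−t_{xy} Re⟨ψ, c†_{xσ}c_{yσ}ψ⟩) − 2Re⟨η, J_dψ⟩ + (Re⟨η,H₀η⟩ − E₀‖η‖²)`,
`J_d = T(i t d) = ∂_θH(θd)|₀`. [cite: ScalapinoWhiteZhang1993, §II; ParamekantiTrivediRanderia1998,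
§IV] -/
@[conjecture] def TrialDirectionStiffnessCeilingOneForm : Prop :=
  ∀ (Λ : Type) [LinearOrder Λ] [Fintype Λ] (t d : Λ → Λ → ℝ),
    (∀ x y, t y x = t x y) → (∀ x y, d y x = -d x y) →
    ∀ (V : Matrix (Finset (Orb Λ)) (Finset (Orb Λ)) ℂ), V.IsHermitian →
    ∀ (N : ℕ) (M ρ θ₀ : ℝ), 0 < θ₀ →
    (∀ θ : ℝ, |θ| ≤ θ₀ →
      ρ * θ ^ 2 ≤
        ((bdgHopping fun x y => (t x y : ℂ) * Complex.exp (((θ * d x y : ℝ) : ℂ) * Complex.I)) +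
              V).minEnergyOn (szSector N M) -
          ((bdgHopping fun x y => (t x y : ℂ)) + V).minEnergyOn (szSector N M)) →
    ∀ ψ : Fock (Orb Λ), IsGroundStateInSector ((bdgHopping fun x y => (t x y : ℂ)) + V) N M ψ →
      star ψ ⬝ᵥ ψ = 1 → ∀ η : Fock (Orb Λ), η ∈ szSector N M →
      ρ ≤ (∑ x : Λ, ∑ y : Λ, ∑ σ : Fin 2, d x y ^ 2 *
            (-(t x y * (star ψ ⬝ᵥ ((creation (orb x σ) * annihilation (orb y σ)) *ᵥ ψ)).re) /
              2)) -
          2 * (star η ⬝ᵥ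
            (bdgHopping (fun x y => ((t x y * d x y : ℝ) : ℂ) * Complex.I) *ᵥ ψ)).re +
          ((star η ⬝ᵥ (((bdgHopping fun x y => (t x y : ℂ)) + V) *ᵥ η)).re -
            ((bdgHopping fun x y => (t x y : ℂ)) + V).minEnergyOn (szSector N M) *
              (star η ⬝ᵥ η).re)

/-- **`TrialDirectionStiffnessCeilingOneForm` holds** (Rayleigh–Ritz at `±θ` with `ψ ∓ θη`
(`comb`), odd terms cancel, `θ → 0` by `le_of_forall_trialFlux₃`). -/
theorem trialDirectionStiffnessCeilingOneForm_holds : TrialDirectionStiffnessCeilingOneForm := by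
  intro Λ _ _ t d ht hd V hV N M ρ θ₀ hθ₀ hstiff ψ hgs h1 η hη
  have hH0 : ((bdgHopping fun x y => (t x y : ℂ)) + V).IsHermitian :=
    (isHermitian_bdgHopping_real ht).add hV
  have hHθ : ∀ θ : ℝ, ((bdgHopping fun x y =>
      (t x y : ℂ) * Complex.exp (((θ * d x y : ℝ) : ℂ) * Complex.I)) + V).IsHermitian :=
    fun θ => (isHermitian_bdgHopping_peierls ht (u := fun x y => θ * d x y) fun x y => by
      rw [hd x y]; ring).add hV
  have hK : ∀ θ : ℝ,
      (bdgHopping fun x y => ((t x y * (Real.cos (θ * d x y) - 1) : ℝ) : ℂ)).IsHermitian :=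
    fun θ => isHermitian_bdgHopping_real fun x y => by rw [ht x y, hd x y, mul_neg, Real.cos_neg]
  have hJ : ∀ θ : ℝ,
      (bdgHopping fun x y => ((t x y * Real.sin (θ * d x y) : ℝ) : ℂ) * Complex.I).IsHermitian :=
    fun θ => isHermitian_bdgHopping_I fun x y => by
      rw [ht x y, hd x y, mul_neg, Real.sin_neg, mul_neg]
  obtain ⟨hψS, -, hHψ⟩ := hgs
  have h1re : (star ψ ⬝ᵥ ψ).re = 1 := by rw [h1, Complex.one_re]
  have hE : (star ψ ⬝ᵥ (((bdgHopping fun x y => (t x y : ℂ)) + V) *ᵥ ψ)).re =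
      ((bdgHopping fun x y => (t x y : ℂ)) + V).minEnergyOn (szSector N M) := by
    rw [hHψ, dotProduct_smul, h1, smul_eq_mul, mul_one, Complex.ofReal_re]
  have hηH : (star η ⬝ᵥ (((bdgHopping fun x y => (t x y : ℂ)) + V) *ᵥ ψ)).re =
      ((bdgHopping fun x y => (t x y : ℂ)) + V).minEnergyOn (szSector N M) * (star η ⬝ᵥ ψ).re := by
    rw [hHψ, dotProduct_smul, smul_eq_mul, Complex.re_ofReal_mul]
  -- the trial inequality at flux `θ'` with `ψ + m η`, combined with the stiffness hypothesis
  have comb : ∀ θ' m : ℝ, |θ'| ≤ θ₀ →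
      ρ * θ' ^ 2 * (1 + 2 * m * (star η ⬝ᵥ ψ).re + m ^ 2 * (star η ⬝ᵥ η).re) ≤
        m ^ 2 * ((star η ⬝ᵥ (((bdgHopping fun x y => (t x y : ℂ)) + V) *ᵥ η)).re -
            ((bdgHopping fun x y => (t x y : ℂ)) + V).minEnergyOn (szSector N M) *
              (star η ⬝ᵥ η).re) +
          ((star ψ ⬝ᵥ ((bdgHopping fun x y =>
              ((t x y * (Real.cos (θ' * d x y) - 1) : ℝ) : ℂ)) *ᵥ ψ)).re +
            2 * m * (star η ⬝ᵥ ((bdgHopping fun x y =>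
              ((t x y * (Real.cos (θ' * d x y) - 1) : ℝ) : ℂ)) *ᵥ ψ)).re +
            m ^ 2 * (star η ⬝ᵥ ((bdgHopping fun x y =>
              ((t x y * (Real.cos (θ' * d x y) - 1) : ℝ) : ℂ)) *ᵥ η)).re) +
          ((star ψ ⬝ᵥ ((bdgHopping fun x y =>
              ((t x y * Real.sin (θ' * d x y) : ℝ) : ℂ) * Complex.I) *ᵥ ψ)).re +
            2 * m * (star η ⬝ᵥ ((bdgHopping fun x y =>
              ((t x y * Real.sin (θ' * d x y) : ℝ) : ℂ) * Complex.I) *ᵥ ψ)).re +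
            m ^ 2 * (star η ⬝ᵥ ((bdgHopping fun x y =>
              ((t x y * Real.sin (θ' * d x y) : ℝ) : ℂ) * Complex.I) *ᵥ η)).re) := by
    intro θ' m hθ'
    have hχS : ψ + (m : ℂ) • η ∈ szSector N M :=
      Submodule.add_mem _ hψS (Submodule.smul_mem _ _ hη)
    have hray := minEnergyOn_mul_re_le (hHθ θ') (szSector N M) hχS
    have hassoc : bdgHopping (fun x y => (t x y : ℂ)) +
          bdgHopping (fun x y => ((t x y * (Real.cos (θ' * d x y) - 1) : ℝ) : ℂ)) +
          bdgHopping (fun x y => ((t x y * Real.sin (θ' * d x y) : ℝ) : ℂ) * Complex.I) + V =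
        (bdgHopping (fun x y => (t x y : ℂ)) + V) +
          bdgHopping (fun x y => ((t x y * (Real.cos (θ' * d x y) - 1) : ℝ) : ℂ)) +
          bdgHopping (fun x y => ((t x y * Real.sin (θ' * d x y) : ℝ) : ℂ) * Complex.I) := by
      abel
    have hsplit : (star (ψ + (m : ℂ) • η) ⬝ᵥ (((bdgHopping fun x y =>
        (t x y : ℂ) * Complex.exp (((θ' * d x y : ℝ) : ℂ) * Complex.I)) + V) *ᵥ
          (ψ + (m : ℂ) • η))).re =
        (star (ψ + (m : ℂ) • η) ⬝ᵥ (((bdgHopping fun x y => (t x y : ℂ)) + V) *ᵥ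
            (ψ + (m : ℂ) • η))).re +
          (star (ψ + (m : ℂ) • η) ⬝ᵥ ((bdgHopping fun x y =>
            ((t x y * (Real.cos (θ' * d x y) - 1) : ℝ) : ℂ)) *ᵥ (ψ + (m : ℂ) • η))).re +
          (star (ψ + (m : ℂ) • η) ⬝ᵥ ((bdgHopping fun x y =>
            ((t x y * Real.sin (θ' * d x y) : ℝ) : ℂ) * Complex.I) *ᵥ (ψ + (m : ℂ) • η))).re := by
      rw [bdgHopping_peierls_split, hassoc, add_mulVec, add_mulVec, dotProduct_add, dotProduct_add,
        Complex.add_re, Complex.add_re]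
    rw [hsplit, re_quadForm_add_smul hH0, re_quadForm_add_smul (hK θ'),
      re_quadForm_add_smul (hJ θ'), re_normSq_add_smul, h1re, hE, hηH] at hray
    have hn0 : 0 ≤ 1 + 2 * m * (star η ⬝ᵥ ψ).re + m ^ 2 * (star η ⬝ᵥ η).re := by
      have h0 := (Complex.nonneg_iff.1 (dotProduct_star_self_nonneg (ψ + (m : ℂ) • η))).1
      rw [re_normSq_add_smul, h1re] at h0
      exact h0
    have hmul := mul_le_mul_of_nonneg_right (hstiff θ' hθ') hn0
    linarith
  -- expansions of the limiting weights
  have hJd := re_star_dotProduct_bdgHopping_I_mulVec (fun x y => t x y * d x y) η ψ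
  beta_reduce at hJd
  have hlim := le_of_forall_trialFlux₃ hθ₀ t d
    (fun x y σ => (star ψ ⬝ᵥ ((creation (orb x σ) * annihilation (orb y σ)) *ᵥ ψ)).re)
    (fun x y σ => (star η ⬝ᵥ ((creation (orb x σ) * annihilation (orb y σ)) *ᵥ η)).re)
    (fun x y σ => (star η ⬝ᵥ ((creation (orb x σ) * annihilation (orb y σ)) *ᵥ ψ)).im)
    (c := (star η ⬝ᵥ η).re)
    (r := (star η ⬝ᵥ (((bdgHopping fun x y => (t x y : ℂ)) + V) *ᵥ η)).re -
      ((bdgHopping fun x y => (t x y : ℂ)) + V).minEnergyOn (szSector N M) * (star η ⬝ᵥ η).re)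
    fun θ hθ hθ1 => by
      have hθp : |θ| ≤ θ₀ := by rw [abs_of_pos hθ]; exact hθ1
      have hθm : |(-θ)| ≤ θ₀ := by rw [abs_neg, abs_of_pos hθ]; exact hθ1
      have hp := comb θ (-θ) hθp
      have hm := comb (-θ) θ hθm
      rw [bdgHopping_cos_neg t d θ, bdgHopping_sin_neg t d θ] at hm
      simp only [Matrix.neg_mulVec, dotProduct_neg, Complex.neg_re] at hm
      have hk₀ := re_star_dotProduct_bdgHopping_real_mulVec
        (fun x y => t x y * (Real.cos (θ * d x y) - 1)) ψ
      have hk₂ := re_star_dotProduct_bdgHopping_real_mulVec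
        (fun x y => t x y * (Real.cos (θ * d x y) - 1)) η
      have hj₁ := re_star_dotProduct_bdgHopping_I_mulVec
        (fun x y => t x y * Real.sin (θ * d x y)) η ψ
      beta_reduce at hk₀ hk₂ hj₁
      rw [hk₀, hk₂, hj₁] at hp hm
      nlinarith [hp, hm]
  beta_reduce at hlim
  rw [hJd]
  linarith

end Summit.HubbardSuperconductivity.HubbardLadder.Bounds

end
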